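import Summits.ResolutionOfSingularities.ResolutionOfSingularities.Theorems.WildQuotientsGaloisQuotientAlterationPerfectDescent
import Summits.ResolutionOfSingularities.ResolutionOfSingularities.Theorems.WildQuotientsGaloisQuotientAlterationReductions
import Literature.AlgebraicGeometry.Motives.RatFnBirational
import Literature.AlgebraicGeometry.Resolution.StrictNormalCrossings
import HarnessLib

/-!
# WildQuotients / `GaloisQuotientAlteration` (stmt-ResolutionOfSingularities-16323) from de Jong's
# Galois alteration over PERFECT fields

Route `ResolutionOfSingularities/WildQuotients`, support item `GaloisQuotientAlteration` (de Jong
1997, Thm. 5.13 / Cor. 5.15 through the quotient by a finite group; every field of characteristic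
`p`). The bridge assembled here:

* `galoisQuotientAlteration_of_forall_perfectField_galoisAlterationDatum` — **the item follows
  from de Jong's Galois alteration datum with PROJECTIVE regular source for NORMAL PROJECTIVE
  varieties over PERFECT fields of characteristic `p`** (de Jong 1996, Thm. 7.3; de Jong 1997,
  (5.12.1) + Thm. 5.13 + Cor. 5.15 over a perfect field). Chain: the item reduces to projective
  `X` over `k` (`galoisQuotientAlterationAt_of_forall_isProjectiveOver`, Chow); the Galois-type
  quotient presentation of a projective `X` comes from a Galois alteration datum of `X`
  (`galoisQuotientAlterationAt_of_deJong`, SGA 1 V / Mumford AV §7, in tree); that datum descends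
  from a projective datum of `X^∞ = (Spec K ×_k X)_red`, `K = k^{p^{-∞}}`
  (`galoisAlterationDatum_of_perfectClosure`); and the latter is the hypothesis applied to the
  normalisation of the projective `K`-variety `X^∞` (projectivity is stable under base change and
  normalisation; the normalisation is a modification, so (d) transfers).
* `galoisQuotientAlteration_of_deJong1997PairPerfect` — the same from de Jong's theorem in the
  PAIR format over perfect fields, verbatim the statement `deJong1997_pair_perfect` of the line
  `FramePerfect` of the sibling crux `SummitReduction` (stmt-16324), taken at the trivial pair
  `(X, {1})`, `Z = ∅`: when that line closes, this item closes by this theorem.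

Everything is proved; the two theorems are conditional only through their explicit hypotheses.
-/

noncomputable section

set_option linter.dupNamespace false -- mandated namespace of this single-conjunct summit

namespace Summit.ResolutionOfSingularities.ResolutionOfSingularities.Theorems

open CategoryTheory CategoryTheory.Limits AlgebraicGeometry TopologicalSpace
open Literature.AlgebraicGeometry.Resolution Literature.AlgebraicGeometry
open Literature.AlgebraicGeometry.Motives (RatFn.functionFieldMap RatFn.functionFieldMap_comp)
open Scheme.IdealSheafData

-- as in Mathlib's pullback API for schemes
set_option backward.isDefEq.respectTransparency false in
/-- **`GaloisQuotientAlteration` from de Jong's Galois alteration over perfect fields.** If every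
NORMAL integral PROJECTIVE variety `X` over every PERFECT field `K` of characteristic `p > 0`
admits a Galois alteration datum with projective source — a finite group `G` acting on a regular
integral `X₁` projective over `K`, a `G`-invariant alteration `π : X₁ → X`, and every
`G`-invariant rational function on `X₁` having a `qⁿ`-th power in `π♯ K(X)` (de Jong 1996,
Thm. 7.3; de Jong 1997, Thm. 5.13 / Cor. 5.15) — then `GaloisQuotientAlteration` holds over
EVERY field of characteristic `p`: Chow's lemma over `k`, base change to the perfect closure and
normalisation, descent of the datum from the perfect closure
(`galoisAlterationDatum_of_perfectClosure`), quotient by the finite group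
(`galoisQuotientAlterationAt_of_deJong`). [cite: DeJong1996, Thm. 7.3, p. 88]
[cite: DeJong1997, Thm. 5.13 and Cor. 5.15, pp. 619–620] -/
theorem galoisQuotientAlteration_of_forall_perfectField_galoisAlterationDatum
    (H : ∀ (p : ℕ), p.Prime → ∀ (K : Type) [Field K] [CharP K p] [PerfectField K]
      (X : Scheme.{0}) [IsIntegral X] (f : X ⟶ Spec (.of K)),
      IsSeparated f → LocallyOfFiniteType f → QuasiCompact f →
      (∀ x : X, IsIntegrallyClosed (X.presheaf.stalk x)) →
      Motives.IsProjectiveOver (Over.mk f) →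
      ∃ (G : Type) (_ : Group G) (_ : Finite G) (X₁ : Scheme.{0}) (_ : IsIntegral X₁)
        (ρ : G →* Aut X₁) (π : X₁ ⟶ X) (_ : IsDominant π),
        IsAlteration π ∧ Scheme.IsRegular X₁ ∧ (∀ g : G, (ρ g).hom ≫ π = π) ∧
        Motives.IsProjectiveOver (Over.mk (π ≫ f)) ∧
        (∀ a : X₁.functionField, (∀ g : G, RatFn.functionFieldMap (ρ g).hom a = a) →
          ∃ n : ℕ, a ^ ringExpChar X.functionField ^ n ∈ Set.range (RatFn.functionFieldMap π))) :
    Summit.ResolutionOfSingularities.ResolutionOfSingularities.Theses.WildQuotients.GaloisQuotientAlteration := by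
  refine galoisQuotientAlteration_of_forall_isProjectiveOver fun p hp k _ _ X f hX hproj => ?_
  haveI := hX
  haveI : Fact p.Prime := ⟨hp⟩
  haveI : IsProper f := isProper_of_isProjectiveOver f hproj
  apply galoisQuotientAlterationAt_of_deJong hp X f
  -- the Galois alteration datum of `X` descends from the perfect closure
  haveI := irreducibleSpace_pullback_perfectClosure p f
  haveI hinf : IsIntegral (vanishingIdeal (⊤ : Closeds
      ↑(pullback (Spec.map (CommRingCat.ofHom (PerfectClosure.of k p))) f))).subscheme :=
    isIntegral_subscheme_vanishingIdeal_top
  refine galoisAlterationDatum_of_perfectClosure p f hproj ?_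
  -- ### the projective datum over `K = k^{p^{-∞}}` for `X^∞`
  letI : Algebra k (PerfectClosure k p) := (PerfectClosure.of k p).toAlgebra
  let σK : CommRingCat.of k ⟶ CommRingCat.of (PerfectClosure k p) :=
    CommRingCat.ofHom (PerfectClosure.of k p)
  let XK := pullback (Spec.map σK) f
  let Xinf := (vanishingIdeal (⊤ : Closeds ↑XK)).subscheme
  let ι₀ : Xinf ⟶ XK := (vanishingIdeal (⊤ : Closeds ↑XK)).subschemeι
  let finf : Xinf ⟶ Spec (.of (PerfectClosure k p)) := ι₀ ≫ pullback.fst (Spec.map σK) f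
  haveI : IsProper finf := inferInstanceAs (IsProper (ι₀ ≫ pullback.fst (Spec.map σK) f))
  -- `X^∞` is projective over `K`
  have hprojK : Motives.IsProjectiveOver
      (Over.mk finf : Motives.SchemeOver (PerfectClosure k p)) := by
    obtain ⟨N, emb, hemb⟩ := hproj.baseChange_obj (PerfectClosure k p)
    haveI := hemb
    let sym := pullbackSymmetry (Spec.map σK) f
    refine ⟨N, Over.homMk (ι₀ ≫ sym.hom ≫ emb.left) ?_, ?_⟩
    · change (ι₀ ≫ sym.hom ≫ emb.left) ≫ (Motives.projectiveSpace N (PerfectClosure k p)).hom =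
        ι₀ ≫ pullback.fst (Spec.map σK) f
      rw [Category.assoc, Category.assoc, Over.w emb]
      change ι₀ ≫ sym.hom ≫ pullback.snd f (Spec.map σK) = ι₀ ≫ pullback.fst (Spec.map σK) f
      rw [pullbackSymmetry_hom_comp_snd]
    · change IsClosedImmersion (ι₀ ≫ sym.hom ≫ emb.left)
      infer_instance
  -- the normalisation of `X^∞`: normal, integral, projective over `K`, birational
  let ν := normalizationι Xinf
  have hνpi : IsPurelyInseparableAlteration ν := isPurelyInseparableAlteration_normalizationι Xinf finf
  haveI := hνpi.isIntegral
  haveI := hνpi.isProper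
  haveI : IsDominant ν := hνpi.isDominant
  have hνsurj : Function.Surjective (RatFn.functionFieldMap ν) := by
    obtain ⟨U, hU, hU', hiso⟩ := isBirational_normalizationι Xinf finf
    haveI := hiso
    exact Motives.RatFn.functionFieldMap_surjective_of_isIso_morphismRestrict ν U hU hU'
  obtain ⟨G, _, _, Y₁, _, ρ, π₁, _, hπ₁, hreg, hinv, hprojY₁, hd⟩ :=
    H p hp (PerfectClosure k p) (normalization Xinf) (ν ≫ finf) inferInstance inferInstance
      inferInstance (isIntegrallyClosed_stalk_normalization Xinf)
      (isProjectiveOver_normalization Xinf finf hprojK)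
  haveI := hπ₁.isProper
  -- the exponential characteristics of `K(X^∞)` and of its normalisation agree
  obtain ⟨q, hq⟩ := ExpChar.exists Xinf.functionField
  haveI : ExpChar (normalization Xinf).functionField q :=
    expChar_of_injective_ringHom (RatFn.functionFieldMap ν).injective q
  have hq₁ : ringExpChar (normalization Xinf).functionField = q := ringExpChar.eq _ q
  have hq₂ : ringExpChar Xinf.functionField = q := ringExpChar.eq _ q
  refine ⟨G, inferInstance, inferInstance, Y₁, inferInstance, ρ, π₁ ≫ ν, inferInstance,
    hπ₁.comp hνpi.isAlteration, hreg, fun g => by rw [← Category.assoc, hinv g], ?_, ?_⟩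
  · simpa only [Category.assoc] using hprojY₁
  · intro a ha
    obtain ⟨n, c, hc⟩ := hd a ha
    obtain ⟨d, rfl⟩ := hνsurj c
    refine ⟨n, d, ?_⟩
    rw [RatFn.functionFieldMap_comp ν π₁, RingHom.comp_apply, hc, hq₁, hq₂]

/-- **`GaloisQuotientAlteration` from de Jong's theorem in the PAIR format over perfect fields**
(de Jong 1997, (5.12.1) for pairs `(X, G)` with `X` normal projective over a perfect field, via
Thm. 5.13 + Cor. 5.15; the statement `deJong1997_pair_perfect` of the line `FramePerfect` of the
sibling crux `SummitReduction`, stmt-ResolutionOfSingularities-16324): apply it to the trivial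
pair `(X, {1})` with `Z = ∅` and forget the boundary.
[cite: DeJong1997, (5.12.1), Thm. 5.13 and Cor. 5.15, pp. 619–620] -/
theorem galoisQuotientAlteration_of_deJong1997PairPerfect
    (HP : ∀ (p : ℕ), p.Prime → ∀ (k : Type) [Field k] [CharP k p] [PerfectField k]
      (X : Scheme.{0}) [IsIntegral X] (f : X ⟶ Spec (.of k)),
      IsSeparated f → LocallyOfFiniteType f → QuasiCompact f →
      (∀ x : X, IsIntegrallyClosed (X.presheaf.stalk x)) →
      Motives.IsProjectiveOver (Over.mk f) →
      ∀ (G : Type) [Group G] [Finite G] (ρ : G →* Aut X), (∀ g : G, (ρ g).hom ≫ f = f) →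
      ∀ (Z : Set X), IsClosed Z → Z ≠ Set.univ → (∀ g : G, (ρ g).hom.base '' Z ⊆ Z) →
      ∃ (G₁ : Type) (_ : Group G₁) (_ : Finite G₁) (X₁ : Scheme.{0}) (_ : IsIntegral X₁)
        (ρ₁ : G₁ →* Aut X₁) (φ₁ : G₁ →* G) (π₁ : X₁ ⟶ X) (_ : IsDominant π₁),
        Function.Surjective φ₁ ∧ IsAlteration π₁ ∧ Scheme.IsRegular X₁ ∧
        Motives.IsProjectiveOver (Over.mk (π₁ ≫ f)) ∧
        (∀ g : G₁, (ρ₁ g).hom ≫ π₁ = π₁ ≫ (ρ (φ₁ g)).hom) ∧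
        (∀ a : X₁.functionField, (∀ g : G₁, RatFn.functionFieldMap (ρ₁ g).hom a = a) →
          ∃ (n : ℕ) (c : X.functionField), (∀ g : G, RatFn.functionFieldMap (ρ g).hom c = c) ∧
            a ^ ringExpChar X.functionField ^ n = RatFn.functionFieldMap π₁ c) ∧
        ∃ D₁ : Set X₁, IsStrictNormalCrossingsDivisor X₁ D₁ ∧ π₁.base ⁻¹' Z ⊆ D₁ ∧
          (∀ g : G₁, (ρ₁ g).hom.base '' D₁ = D₁) ∧
          (∀ (g : G₁) (C : Set X₁), Maximal (fun C : Set X₁ => IsIrreducible C ∧ C ⊆ D₁) C →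
            (C ∩ (ρ₁ g).hom.base '' C).Nonempty → (ρ₁ g).hom.base '' C = C)) :
    Summit.ResolutionOfSingularities.ResolutionOfSingularities.Theses.WildQuotients.GaloisQuotientAlteration := by
  refine galoisQuotientAlteration_of_forall_perfectField_galoisAlterationDatum
    fun p hp K _ _ _ X _ f hs hl hq hN hproj => ?_
  have hZ : (∅ : Set X) ≠ Set.univ := fun h => by
    have hne : (Set.univ : Set X).Nonempty := Set.univ_nonempty
    rw [← h] at hne
    exact Set.not_nonempty_empty hne
  obtain ⟨G₁, _, _, X₁, _, ρ₁, φ₁, π₁, _, -, hπ₁, hreg, hprojX₁, hinv, hd, -⟩ :=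
    HP p hp K X f hs hl hq hN hproj PUnit (1 : PUnit →* Aut X) (fun _ => by
      rw [map_one]; exact Category.id_comp f) ∅ isClosed_empty hZ (fun _ => by simp)
  refine ⟨G₁, inferInstance, inferInstance, X₁, inferInstance, ρ₁, π₁, inferInstance, hπ₁, hreg,
    fun g => ?_, hprojX₁, fun a ha => ?_⟩
  · rw [hinv g, map_one]
    exact Category.comp_id π₁
  · obtain ⟨n, c, -, hc⟩ := hd a ha
    exact ⟨n, c, hc.symm⟩

end Summit.ResolutionOfSingularities.ResolutionOfSingularities.Theorems

end
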